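import Literature.NumberTheory.EllipticCurves.LambdaAdicSelmerDataToCoeffLimitH1
import Literature.NumberTheory.EllipticCurves.LambdaAdicSelmerDataToCoeffTwistH1Iterate
import HarnessLib

/-!
# The level maps of the Kolyvagin-system pushforward from the Shapiro-diagonal `Λ`-adic source to Howard's Eisenstein
# specialisation: `Λ/(ω_σ, p^σ) ↠ A_{m,k}` for `σ ≫ 0`, the intertwining map
# `E[p^σ] ⊗ (Λ/(ω_σ, p^σ))(ψ⁻¹) → E[p^k] ⊗ A_{m,k}(ψ⁻¹)`, and its effect on the comparison `Φ`:
# `H¹(f) (Φ z)_σ = (k-th component of the compact control map of z)` (definitions with bodies + theorems)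

Topic `NumberTheory/EllipticCurves` (sequel of `ZpExtensionCoeffAdicTower`, `LambdaAdicSelmerDataToCoeffLimitH1`,
`…ToCoeffTwistH1Iterate`). Cell `pub/bsd-print-x9`, seat `bsd-line-x9-p2` (g3): the `f k` data of the
`CoeffTowerSetting.Hom (Λ ↠ Λ/(q_m)) (S_Λ.reindex σ) (specSetting …).toCoeffTowerSetting` of STUB 2 (x9-p1 LEAD g3 16:08:30Z
(q2)(a),(d); lit g31 16:15:31Z «reduce coefficients Λ/(ω_{σk}, p^{σk}) ↠ Λ/(q_m, p^{k+1}) and E[p^{σk}] ↠ E[p^{k+1}], available iff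
ω_{σk} ∈ (q_m, p^{k+1}) and σ k ≥ k+1»), and the identity «`one′ k = H¹(f k)(one (σ k))` = D1's control map on `z`» ON `Φ`.

* `shapiroIdeal_le_eisensteinIdeal` (`ω_σ ∈ (q_m, p^k)`, `k ≤ σ` ⇒ `(ω_σ, p^σ) ≤ (q_m, p^k)`), `exists_forall_shapiroIdeal_le`
  (holds for all `σ ≥ S(m,k)`); `shapiroToEisensteinCoeff` (the ring map, `Ideal.Quotient.factor`) + `_coeffLevelUnit`
  (`[1+T] ↦ 1+T`);
* **`shapiroToEisensteinTwist κ t hm k d hle : E[p^{k+d}] ⊗ (Λ/(ω_{k+d}, p^{k+d}))(χ) →ⁱL E[p^k] ⊗ A_{m,k}(χ)`**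
  (`coeffTwistReduce` along `shapiroToEisensteinCoeff` and `torsionReduceIter t k d`);
* **`map_shapiroToEisensteinTwist_toShapiroLimitH1`**: for `z ∈ 𝔖_p(K_∞)`,
  `H¹(shapiroToEisensteinTwist …) ((Φ z)_{k+d}) = eisensteinComponent D hm k n z` (any layer `n ≥ max (k+d) J_k`), and
  **`…_eq_proj_toEisensteinH1`**: `= I.proj k (D.toEisensteinH1 hm t ht I hγ hE z)` — the pushforward of the source
  Kolyvagin class `Φ(κ_∞)` IS the compact control map of D1 on `κ_∞`, level by level.
DEFINITIONS WITH BODIES + theorems; no named fact, no instance, no notation, no `sorry`. BSD is not proved by any of this.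

References: [Howard2004HeegnerKolyvagin] B. Howard, Compositio Math. 140 (2004), Rem. 1.2.4, Lemma 2.2.7, proof of Thm. 2.2.10
(arXiv Thm. 3.2.10, p0017 L78–81), §2.2 Def. 2.2.3; [Washington1997] §13.2 (Lemma 13.7); [PerrinRiou1987BSMF] §0 p. 402.
-/

noncomputable section

open scoped Topology Classical ContRepresentation
open Field CategoryTheory IsLocalRing

namespace Literature.NumberTheory.EllipticCurves.ZpExtension

open Literature.NumberTheory.GaloisRepresentations

/-! ## §1 The ring maps `Λ/(ω_σ, p^σ) ↠ A_{m,k}` -/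

section Ring

variable (p : ℕ) [hp : Fact p.Prime]

/-- **`(ω_σ, p^σ) ≤ (q_m, p^k)` when `ω_σ ∈ (q_m, p^k)` and `k ≤ σ`.** [cite: Howard2004HeegnerKolyvagin, Lemma 2.2.7 (the local comparison at 𝔮)]
[cite: Washington1997, §13.2 (Lemma 13.7)] -/
theorem shapiroIdeal_le_eisensteinIdeal {m k σ : ℕ}
    (hω : ((1 + PowerSeries.X : IwasawaAlgebra p) ^ (p ^ σ) - 1) ∈
      Ideal.span {(PowerSeries.X ^ m + PowerSeries.C (p : ℤ_[p]) : IwasawaAlgebra p)} ⊔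
        Ideal.span {PowerSeries.C ((p : ℤ_[p]) ^ k)})
    (hkσ : k ≤ σ) :
    shapiroIdeal p σ ≤ Ideal.span {(PowerSeries.X ^ m + PowerSeries.C (p : ℤ_[p]) : IwasawaAlgebra p)} ⊔
      Ideal.span {PowerSeries.C ((p : ℤ_[p]) ^ k)} := by
  refine sup_le ((Ideal.span_singleton_le_iff_mem _).mpr hω) ((Ideal.span_singleton_le_iff_mem _).mpr ?_)
  refine Ideal.mem_sup_right (Ideal.mem_span_singleton.mpr ?_)
  rw [map_pow, map_natCast]
  exact pow_dvd_pow _ hkσ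

/-- **For all `σ ≥ S(m,k)`, `(ω_σ, p^σ) ≤ (q_m, p^k)`** (`1 + T` has `p`-power order in `A_{m,k}ˣ`,
`exists_forall_onePlusX_pow_prime_pow_sub_one_mem`). [cite: Howard2004HeegnerKolyvagin, Lemma 2.2.7 and Prop. 2.2.8] -/
theorem exists_forall_shapiroIdeal_le {m : ℕ} (hm : 1 ≤ m) (k : ℕ) :
    ∃ S : ℕ, ∀ σ : ℕ, S ≤ σ →
      shapiroIdeal p σ ≤ Ideal.span {(PowerSeries.X ^ m + PowerSeries.C (p : ℤ_[p]) : IwasawaAlgebra p)} ⊔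
        Ideal.span {PowerSeries.C ((p : ℤ_[p]) ^ k)} := by
  obtain ⟨J, hJ⟩ := IwasawaAlgebra.exists_forall_onePlusX_pow_prime_pow_sub_one_mem p hm k
  exact ⟨max J k, fun σ hσ ↦ shapiroIdeal_le_eisensteinIdeal p (hJ σ (le_of_max_le_left hσ)) (le_of_max_le_right hσ)⟩

/-- **The ring map `Λ/(ω_σ, p^σ) ↠ A_{m,k}`** (`Ideal.Quotient.factor`), the coefficient part of the pushforward's level
map `f k` out of the (reindexed) Shapiro-diagonal source. [cite: Howard2004HeegnerKolyvagin, Rem. 1.2.4 (R → R′) and Lemma 2.2.7] -/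
def shapiroToEisensteinCoeff {m k σ : ℕ}
    (hle : shapiroIdeal p σ ≤ Ideal.span {(PowerSeries.X ^ m + PowerSeries.C (p : ℤ_[p]) : IwasawaAlgebra p)} ⊔
      Ideal.span {PowerSeries.C ((p : ℤ_[p]) ^ k)}) :
    IwasawaAlgebra p ⧸ shapiroIdeal p σ →+* IwasawaAlgebra.EisensteinCoeff p m k :=
  Ideal.Quotient.factor hle

/-- `shapiroToEisensteinCoeff` on classes: `[g] ↦ [g]`. [cite: Howard2004HeegnerKolyvagin, Rem. 1.2.4] -/
theorem shapiroToEisensteinCoeff_mk {m k σ : ℕ}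
    (hle : shapiroIdeal p σ ≤ Ideal.span {(PowerSeries.X ^ m + PowerSeries.C (p : ℤ_[p]) : IwasawaAlgebra p)} ⊔
      Ideal.span {PowerSeries.C ((p : ℤ_[p]) ^ k)}) (g : IwasawaAlgebra p) :
    shapiroToEisensteinCoeff p hle (Ideal.Quotient.mk _ g) = Ideal.Quotient.mk _ g :=
  Ideal.Quotient.factor_mk _ _

/-- `shapiroToEisensteinCoeff [1+T] = 1+T`. [cite: Howard2004HeegnerKolyvagin, §2.2 (γ ↦ 1 + T)] -/
theorem shapiroToEisensteinCoeff_coeffLevelUnit {m k σ : ℕ}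
    (hle : shapiroIdeal p σ ≤ Ideal.span {(PowerSeries.X ^ m + PowerSeries.C (p : ℤ_[p]) : IwasawaAlgebra p)} ⊔
      Ideal.span {PowerSeries.C ((p : ℤ_[p]) ^ k)}) :
    shapiroToEisensteinCoeff p hle (coeffLevelUnit (shapiroIdeal p) σ) = IwasawaAlgebra.EisensteinCoeff.onePlusT p m k := by
  rw [shapiroToEisensteinCoeff_mk, IwasawaAlgebra.EisensteinCoeff.onePlusT_def]

/-- `shapiroToEisensteinCoeff` is surjective. [cite: Howard2004HeegnerKolyvagin, Rem. 1.2.4] -/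
theorem shapiroToEisensteinCoeff_surjective {m k σ : ℕ}
    (hle : shapiroIdeal p σ ≤ Ideal.span {(PowerSeries.X ^ m + PowerSeries.C (p : ℤ_[p]) : IwasawaAlgebra p)} ⊔
      Ideal.span {PowerSeries.C ((p : ℤ_[p]) ^ k)}) :
    Function.Surjective (shapiroToEisensteinCoeff p hle) :=
  Ideal.Quotient.factor_surjective hle

end Ring

/-! ## §2 The intertwining level map and its effect on `Φ` -/

section Twist

variable {K : Type} [Field K] [NumberField K] {V : WeierstrassCurve K} [V.IsElliptic] {p : ℕ} [hp : Fact p.Prime]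
  (κ : ZpExtension K p)
  (t : ∀ k, (V.torsionGaloisModule ((p : ℤ) ^ (k + 1))).toContRepresentation →ⁱL
    (V.torsionGaloisModule ((p : ℤ) ^ k)).toContRepresentation)
  {m : ℕ} (hm : 1 ≤ m)

/-- **The level map `E[p^{k+d}] ⊗ (Λ/(ω_{k+d}, p^{k+d}))(χ) → E[p^k] ⊗ A_{m,k}(χ)`** of the pushforward out of the Shapiro
source at level `σ = k + d` (coefficients `shapiroToEisensteinCoeff`, module part `p^d ·` = `torsionReduceIter`), as a morphism
of the twisted discrete Galois modules; the target IS `κ.eisensteinTwist (E[p^k]) hm k` (`coeffTwist_eisenstein`).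
[cite: Howard2004HeegnerKolyvagin, Rem. 1.2.4, Lemma 2.2.7 and proof of Thm. 2.2.10 (arXiv p0017 L78–81)] -/
def shapiroToEisensteinTwist (k d : ℕ)
    (hle : shapiroIdeal p (k + d) ≤ Ideal.span {(PowerSeries.X ^ m + PowerSeries.C (p : ℤ_[p]) : IwasawaAlgebra p)} ⊔
      Ideal.span {PowerSeries.C ((p : ℤ_[p]) ^ k)}) :
    (κ.coeffTwist (V.torsionGaloisModule ((p : ℤ) ^ (k + d))) (coeffLevelUnit (shapiroIdeal p) (k + d)) (k + d)
        (mk_one_add_X_pow_prime_pow_eq_one (shapiroIdeal p (k + d)) (omega_mem_shapiroIdeal p (k + d)))).toContRepresentation →ⁱL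
      (κ.eisensteinTwist (V.torsionGaloisModule ((p : ℤ) ^ k)) hm k).toContRepresentation :=
  κ.coeffTwistReduce (mk_one_add_X_pow_prime_pow_eq_one (shapiroIdeal p (k + d)) (omega_mem_shapiroIdeal p (k + d)))
    (onePlusT_pow_prime_pow_eisensteinLevel (p := p) hm k) (shapiroToEisensteinCoeff p hle)
    (shapiroToEisensteinCoeff_coeffLevelUnit p hle) (WeierstrassCurve.LambdaAdicSelmerData.torsionReduceIter t k d)

variable {κ} {γ : absoluteGaloisGroup K} (D : V.LambdaAdicSelmerData κ γ)
  (ht : ∀ k (P : WeierstrassCurve.geomTorsion V ((p : ℤ) ^ (k + 1))), t k P = V.geomTorsionReduce p k P)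
  (hts : ∀ k, Function.Surjective (t k))

include ht in
omit [V.IsElliptic] in
/-- **`H¹(f) ∘ comp_{k+d} = eisensteinComponent_k`** for the level map `f` out of Shapiro level `σ = k + d`, on the source
level maps of `𝔖` at any common layer `n` (`map_coeffTwistReduce_coeffComponent_reduceIter_eq_eisensteinComponent`).
[cite: Howard2004HeegnerKolyvagin, proof of Thm. 2.2.10 (arXiv p0017 L78–81)] -/
theorem map_shapiroToEisensteinTwist_coeffComponent (k d n : ℕ) (hn : k + d ≤ n)
    (hn' : eisensteinLevel (p := p) hm k ≤ n)
    (hle : shapiroIdeal p (k + d) ≤ Ideal.span {(PowerSeries.X ^ m + PowerSeries.C (p : ℤ_[p]) : IwasawaAlgebra p)} ⊔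
      Ideal.span {PowerSeries.C ((p : ℤ_[p]) ^ k)}) (z : D.S) :
    galoisCohomology.map ((κ.unitTwist (-1)).shapiroToEisensteinTwist t hm k d hle) 1
        (D.coeffComponent (mk_one_add_X_pow_prime_pow_eq_one (shapiroIdeal p (k + d)) (omega_mem_shapiroIdeal p (k + d)))
          (k + d) n hn z) = D.eisensteinComponent hm k n hn' z :=
  D.map_coeffTwistReduce_coeffComponent_reduceIter_eq_eisensteinComponent t ht _ hm k d n hn hn'
    (shapiroToEisensteinCoeff p hle) (shapiroToEisensteinCoeff_coeffLevelUnit p hle) z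

/-- **On the comparison `Φ`: `H¹(f) (Φ z)_{k+d} = eisensteinComponent D hm k n z`** (any layer `n` above `k + d` and `J_k`).
[cite: Howard2004HeegnerKolyvagin, proof of Thm. 2.2.10 (arXiv p0017 L78–81)] -/
theorem map_shapiroToEisensteinTwist_toShapiroLimitH1 (hγ : κ.IsTopGenerator γ)
    (hE : ∀ P : V.toAffine.Point, p • P = 0 → P = 0) (k d n : ℕ) (hn : k + d ≤ n)
    (hn' : eisensteinLevel (p := p) hm k ≤ n)
    (hle : shapiroIdeal p (k + d) ≤ Ideal.span {(PowerSeries.X ^ m + PowerSeries.C (p : ℤ_[p]) : IwasawaAlgebra p)} ⊔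
      Ideal.span {PowerSeries.C ((p : ℤ_[p]) ^ k)}) (z : D.S) :
    galoisCohomology.map ((κ.unitTwist (-1)).shapiroToEisensteinTwist t hm k d hle) 1
        ((D.toShapiroLimitH1 t ht hts hγ hE z).1 (k + d)) = D.eisensteinComponent hm k n hn' z := by
  change galoisCohomology.map ((κ.unitTwist (-1)).shapiroToEisensteinTwist t hm k d hle) 1
      (D.coeffComponent (mk_one_add_X_pow_prime_pow_eq_one (shapiroIdeal p (k + d)) (omega_mem_shapiroIdeal p (k + d)))
        (k + d) (k + d) le_rfl z) = _
  rw [← D.coeffComponent_eq_self _ hγ hE (k + d) hn z]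
  exact map_shapiroToEisensteinTwist_coeffComponent t hm D ht k d n hn hn' hle z

/-- **`H¹(f) (Φ z)_{k+d} = proj_k (compact control map of z)`**: with the pinned `H¹(K, T_𝔮)` (`I : EisensteinH1Data …`),
the pushforward of the `(k+d)`-th source component of `Φ z` IS the `k`-th projection of D1's `toEisensteinH1 z` — the
identity «`one′ k = H¹(f k)(one (σ k))` is D1's control map on `z`» behind STUB 2's clause `κ.one = ctrl_m z`.
[cite: Howard2004HeegnerKolyvagin, proof of Thm. 2.2.10 (arXiv p0017 L78–81) and §2.2 Def. 2.2.3] -/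
theorem map_shapiroToEisensteinTwist_toShapiroLimitH1_eq_proj_toEisensteinH1 (hγ : κ.IsTopGenerator γ)
    (hE : ∀ P : V.toAffine.Point, p • P = 0 → P = 0)
    (I : ZpExtension.EisensteinH1Data (κ.unitTwist (-1)) (fun k ↦ V.torsionGaloisModule ((p : ℤ) ^ k)) t hm) (k d : ℕ)
    (hle : shapiroIdeal p (k + d) ≤ Ideal.span {(PowerSeries.X ^ m + PowerSeries.C (p : ℤ_[p]) : IwasawaAlgebra p)} ⊔
      Ideal.span {PowerSeries.C ((p : ℤ_[p]) ^ k)}) (z : D.S) :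
    galoisCohomology.map ((κ.unitTwist (-1)).shapiroToEisensteinTwist t hm k d hle) 1
        ((D.toShapiroLimitH1 t ht hts hγ hE z).1 (k + d)) = I.proj k (D.toEisensteinH1 hm t ht I hγ hE z) := by
  rw [D.proj_toEisensteinH1 hm t ht I hγ hE z k (le_max_right (k + d) _)]
  exact map_shapiroToEisensteinTwist_toShapiroLimitH1 t hm D ht hts hγ hE k d _ (le_max_left _ _) (le_max_right _ _) hle z

end Twist

end Literature.NumberTheory.EllipticCurves.ZpExtension

end
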